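import Summits.Ventures.CertifiedManyBodySolver.Transport.PauliMarkovFourier
import HarnessLib

/-!
# Ventures/CertifiedManyBodySolver — Transport/PauliMarkov.lean

HONEST FRAMING: first certified bounds; not a superconductivity verdict; every number certified or labelled float.

**LEMMA PM (Pauli–Markov one-body cut; op-07, `HOME/code/oplayer/TL-FORMULATION.md` §A.6, refereed
ref-1 R1.16).** For every translation-invariant infinite-volume state `ω` of the lattice fermion system
on `ℤ^d` (`InfVolFermionState d`, `IsTranslationInvariant`), every spin `σ`, every lattice direction
`v ≠ 0` and all real coefficients `λ₀, …, λ_R`,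

  `λ₀ ω(n_{0σ}) + Σ_{e=1}^{R} λ_e Re ω(c†_{0σ} c_{e v,σ} + c†_{e v,σ} c_{0σ}) ≤ PM(λ) := (1/2π) ∫₀^{2π} max(p_λ(k), 0) dk`,
  `p_λ(k) = λ₀ + Σ_{e=1}^{R} 2 λ_e cos(e k)`

(`pmValue`, an exact interval integral — no numerics). This is the row family `PM(λ)` of the cell's
chain relaxations (lever L9); it is valid for translation-invariant states of the INFINITE chain and
false for finite-ring pull-backs (TL-FORMULATION §A.6 "VIOLATED by ring pull-backs"), which is why no
ring-wise soundness theorem covers it. With this file a certificate using PM rows reads in the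
torus-limit soundness shape of the tree (move the PM terms into the objective:
`Re ω(h − Σ_i κ_i (B_i 𝟙 − O_{λ_i})) ≤ Re ω(h)` for `κ_i ≥ 0`, `PM(λ_i) ≤ B_i`) and transports to
`M1(Doped)EnergyLowerRow` by `le_hubbardChainEnergyDensityAt_of_forall_torusLimit`
(HubbardChainTorusLimitState.lean, "(I)").

PROOF (finite-dimensional; no Herglotz–Bochner, no Fejér–Riesz). For `W ≥ 1` and `k ∈ ℝ` smear the
annihilation operators along the line with the plane wave `f_j = e^{ikj}`, `j < W`:
`a_k = Σ_{j<W} e^{ikj} c_{j v, σ}`. The CAR give `a_k a_k† + a_k† a_k = W·𝟙`, so the **Fejér-smeared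
momentum density** `n_W(k) := ω(a_k† a_k)/W` lies in `[0, 1]` (`FermionSmearedPauliBound`:
Lieb–Seiringer Thm. 3.2 (3.1.35)); translation invariance gives
`n_W(k) = W⁻¹ Σ_{j,l<W} e^{ik(l−j)} G(l − j)`, `G(m) = ω(c†_{0σ} c_{m v,σ})`. Orthogonality
`∫₀^{2π} e^{imk} dk = 2π[m = 0]` turns `(1/2π)∫ p_λ n_W` into the Fejér-damped row
`Σ_{|m| ≤ R} (1 − |m|/W) λ_{|m|} Re G(m)` (pair count `#{(j,l) : l − j = m} = W − |m|`), while
pointwise `p_λ n_W ≤ max(p_λ, 0)` bounds it by `PM(λ)`; let `W → ∞`.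

Contents (Fourier half in `Transport/PauliMarkovFourier.lean`: `pmSymbol`, `pmCoeff`, `pmValue`,
`integral_cexp_int_mul`, `integral_pmSymbol_mul_cexp`, the pair count / damped-row identity `fejer_sum_eq`):
here `fejerDensity` (+ `= ω(a†a)/W`, `∈ [0,1]`), `integral_pmSymbol_mul_fejerDensity` (+ `_le`),
`dampedRow_eq`, **`InfVolFermionState.IsTranslationInvariant.pauliMarkov`** (two-point form), the operator
`pmOp` with `re_expect_pmOp_le` on any region containing the sites `0, v, …, R v`, its isotony
`fermionEmbed_incl_pmOp`, and the certificate slack forms `re_expect_pmSlack_nonneg` /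
`re_expect_sub_pmSlack_le` (PM rows moved into the objective). No physical notion is defined, no named fact,
no sorry; axioms standard.

References: op-07 TL-FORMULATION.md §A.6 (statement, proof via Herglotz; ref-1 R1.16 PASS);
E. H. Lieb, R. Seiringer, *The Stability of Matter in Quantum Mechanics* (CUP 2010) Thm. 3.2;
O. Bratteli, D. W. Robinson, *OAQSM II* §5.2.2.
-/

noncomputable section

namespace Summit.Ventures.CertifiedManyBodySolver.Transport

open Matrix Finset MeasureTheory intervalIntegral
open Literature.Probability.LatticeModels
open Literature.MathematicalPhysics.QuantumLattice
open scoped ComplexOrder Real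

variable {d : ℕ}

/-! ### §3. The Fejér-smeared momentum density of a translation-invariant state -/

section Fejer

variable (ω : InfVolFermionState d) (σ : Fin 2) (v : Site d)

/-- The sites `0, v, 2v, …, (W-1)v` of the smearing window. -/
def lineSite (v : Site d) (W : ℕ) (j : Fin W) : Site d := ((j : ℕ) : ℤ) • v

/-- Distinct window indices give distinct sites when `v ≠ 0` (`ℤ^d` is torsion free). -/
theorem lineSite_injective {v : Site d} (hv : v ≠ 0) (W : ℕ) : Function.Injective (lineSite v W) := by
  intro j l h
  have h' : (((j : ℕ) : ℤ) - ((l : ℕ) : ℤ)) • v = 0 := by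
    rw [sub_smul]; exact sub_eq_zero.2 h
  rcases smul_eq_zero.1 h' with h0 | h0
  · exact Fin.ext (by omega)
  · exact absurd h0 hv

/-- The window region `{0, v, …, (W-1)v}`. -/
def lineRegion (v : Site d) (W : ℕ) : Finset (Site d) := Finset.univ.image (lineSite v W)

/-- Each window site lies in the window region. -/
theorem lineSite_mem (W : ℕ) (j : Fin W) : lineSite v W j ∈ lineRegion v W :=
  Finset.mem_image_of_mem _ (Finset.mem_univ j)

/-- The plane wave `e^{ikj}` on the window. -/
def planeWave (W : ℕ) (k : ℝ) (j : Fin W) : ℂ := Complex.exp (Complex.I * ((j : ℕ) : ℤ) * k)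

/-- `|e^{ikj}| = 1`. -/
theorem norm_planeWave (W : ℕ) (k : ℝ) (j : Fin W) : ‖planeWave W k j‖ = 1 := by
  rw [planeWave, show Complex.I * (((j : ℕ) : ℤ) : ℂ) * (k : ℂ) = ((j * k : ℝ) : ℂ) * Complex.I by
    push_cast; ring, Complex.norm_exp_ofReal_mul_I]

/-- `conj(e^{ikj}) e^{ikl} = e^{ik(l-j)}`. -/
theorem star_planeWave_mul_planeWave (W : ℕ) (k : ℝ) (j l : Fin W) :
    star (planeWave W k j) * planeWave W k l =
      Complex.exp (Complex.I * (((l : ℕ) : ℤ) - ((j : ℕ) : ℤ) : ℤ) * k) := by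
  rw [planeWave, planeWave, Complex.star_def, ← Complex.exp_conj, ← Complex.exp_add]
  congr 1
  simp only [map_mul, Complex.conj_I, map_intCast, Complex.conj_ofReal]
  push_cast
  ring

/-- **The Fejér-smeared momentum density** of `ω` along `v` (window `W`, spin `σ`), in closed
trigonometric-polynomial form: `n_W(k) = W⁻¹ Re Σ_{j,l<W} e^{ik(l−j)} G(0, (l−j)v)`. -/
def fejerDensity (W : ℕ) (k : ℝ) : ℝ :=
  (W : ℝ)⁻¹ * (∑ j : Fin W, ∑ l : Fin W,
    Complex.exp (Complex.I * (((l : ℕ) : ℤ) - ((j : ℕ) : ℤ) : ℤ) * k) *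
      ω.twoPoint σ 0 ((((l : ℕ) : ℤ) - ((j : ℕ) : ℤ)) • v)).re

/-- `n_W` is continuous in `k` (a trigonometric polynomial). -/
theorem continuous_fejerDensity (W : ℕ) : Continuous (fejerDensity ω σ v W) := by
  unfold fejerDensity
  fun_prop

/-- For translation-invariant `ω`, `n_W(k) = ω(a_k† a_k)/W` with `a_k = Σ_{j<W} e^{ikj} c_{jv,σ}`. -/
theorem fejerDensity_eq_expect (hω : ω.IsTranslationInvariant) (W : ℕ) (k : ℝ) :
    fejerDensity ω σ v W k = (W : ℝ)⁻¹ *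
      (ω.expect (lineRegion v W) ((smearedAnnihilation (lineSite v W) (lineSite_mem v W) σ (planeWave W k))ᴴ *
        smearedAnnihilation (lineSite v W) (lineSite_mem v W) σ (planeWave W k))).re := by
  rw [fejerDensity, ω.expect_smeared_eq_sum]
  congr 2
  refine Finset.sum_congr rfl fun j _ => Finset.sum_congr rfl fun l _ => ?_
  rw [ω.expect_creation_mul_annihilation, hω.twoPoint_eq_zero_sub ω σ (lineSite v W j) (lineSite v W l),
    star_planeWave_mul_planeWave, lineSite, lineSite, ← sub_smul]

/-- **`0 ≤ n_W(k) ≤ 1`** (Pauli bound on the plane-wave smearing; `W ≥ 1`). -/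
theorem fejerDensity_mem_Icc (hω : ω.IsTranslationInvariant) {v : Site d} (hv : v ≠ 0) {W : ℕ} (hW : 0 < W)
    (k : ℝ) : fejerDensity ω σ v W k ∈ Set.Icc 0 1 := by
  rw [fejerDensity_eq_expect ω σ v hω]
  have h := ω.re_expect_smeared_mem_Icc (lineSite_injective hv W) (lineSite_mem v W) σ (planeWave W k)
  simp only [norm_planeWave, one_pow, Finset.sum_const, Finset.card_univ, Fintype.card_fin,
    nsmul_eq_mul, mul_one] at h
  have hW' : (0 : ℝ) < W := by exact_mod_cast hW
  constructor
  · exact mul_nonneg (inv_nonneg.2 hW'.le) h.1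
  · rw [inv_mul_le_iff₀ hW', mul_one]
    exact h.2

/-- **Orthogonality turns `∫ p_λ n_W` into a damped row**:
`∫₀^{2π} p_λ(k) n_W(k) dk = 2π W⁻¹ Σ_{j,l<W} pmCoeff(l−j) Re G(0, (l−j)v)`. -/
theorem integral_pmSymbol_mul_fejerDensity (R : ℕ) (lam : ℕ → ℝ) (W : ℕ) :
    ∫ k in (0 : ℝ)..2 * π, pmSymbol R lam k * fejerDensity ω σ v W k =
      2 * π * (W : ℝ)⁻¹ * ∑ j : Fin W, ∑ l : Fin W,
        pmCoeff R lam (((l : ℕ) : ℤ) - ((j : ℕ) : ℤ)) *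
          (ω.twoPoint σ 0 ((((l : ℕ) : ℤ) - ((j : ℕ) : ℤ)) • v)).re := by
  -- Step 1: the integrand is `W⁻¹ · Re F(k)` with `F` a finite sum of `p(k) e^{i(l-j)k} G_{l-j}`
  have hFre : ∀ k, pmSymbol R lam k * fejerDensity ω σ v W k =
      (W : ℝ)⁻¹ * (∑ j : Fin W, ∑ l : Fin W, (pmSymbol R lam k : ℂ) *
        Complex.exp (Complex.I * (((l : ℕ) : ℤ) - ((j : ℕ) : ℤ) : ℤ) * k) *
          ω.twoPoint σ 0 ((((l : ℕ) : ℤ) - ((j : ℕ) : ℤ)) • v)).re := by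
    intro k
    rw [fejerDensity, mul_left_comm, ← Complex.re_ofReal_mul, Finset.mul_sum]
    congr 2
    refine Finset.sum_congr rfl fun j _ => ?_
    rw [Finset.mul_sum]
    refine Finset.sum_congr rfl fun l _ => ?_
    ring
  simp_rw [hFre]
  rw [intervalIntegral.integral_const_mul]
  -- Step 2: `Re` commutes with the integral
  have hpc := continuous_pmSymbol R lam
  have hcont : Continuous (fun k : ℝ => ∑ j : Fin W, ∑ l : Fin W, (pmSymbol R lam k : ℂ) *
      Complex.exp (Complex.I * (((l : ℕ) : ℤ) - ((j : ℕ) : ℤ) : ℤ) * k) *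
        ω.twoPoint σ 0 ((((l : ℕ) : ℤ) - ((j : ℕ) : ℤ)) • v)) := by
    fun_prop
  have hre := Complex.reCLM.intervalIntegral_comp_comm (hcont.intervalIntegrable (μ := volume) 0 (2 * π))
  simp only [Complex.reCLM_apply] at hre
  rw [hre]
  -- Step 3: integrate term by term
  have hterm : ∀ j l : Fin W, IntervalIntegrable (fun k : ℝ => (pmSymbol R lam k : ℂ) *
      Complex.exp (Complex.I * (((l : ℕ) : ℤ) - ((j : ℕ) : ℤ) : ℤ) * k) *
        ω.twoPoint σ 0 ((((l : ℕ) : ℤ) - ((j : ℕ) : ℤ)) • v)) volume 0 (2 * π) := by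
    intro j l
    apply Continuous.intervalIntegrable
    fun_prop
  have hrow : ∀ j : Fin W, IntervalIntegrable (fun k : ℝ => ∑ l : Fin W, (pmSymbol R lam k : ℂ) *
      Complex.exp (Complex.I * (((l : ℕ) : ℤ) - ((j : ℕ) : ℤ) : ℤ) * k) *
        ω.twoPoint σ 0 ((((l : ℕ) : ℤ) - ((j : ℕ) : ℤ)) • v)) volume 0 (2 * π) := by
    intro j
    apply Continuous.intervalIntegrable
    fun_prop
  rw [intervalIntegral.integral_finsetSum (fun j _ => hrow j)]
  simp_rw [intervalIntegral.integral_finsetSum (fun l _ => hterm _ l), intervalIntegral.integral_mul_const,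
    integral_pmSymbol_mul_cexp]
  -- Step 4: real parts
  simp only [Complex.re_sum, Finset.mul_sum]
  refine Finset.sum_congr rfl fun j _ => Finset.sum_congr rfl fun l _ => ?_
  rw [show (2 : ℂ) * π * (pmCoeff R lam (((l : ℕ) : ℤ) - ((j : ℕ) : ℤ)) : ℂ) =
    ((2 * π * pmCoeff R lam (((l : ℕ) : ℤ) - ((j : ℕ) : ℤ)) : ℝ) : ℂ) by push_cast; ring,
    Complex.re_ofReal_mul]
  ring

/-- **`(1/2π) ∫ p_λ n_W ≤ PM(λ)`** (pointwise `p n ≤ max(p, 0)` for `n ∈ [0, 1]`). -/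
theorem integral_pmSymbol_mul_fejerDensity_le (hω : ω.IsTranslationInvariant) {v : Site d} (hv : v ≠ 0)
    (R : ℕ) (lam : ℕ → ℝ) {W : ℕ} (hW : 0 < W) :
    (2 * π)⁻¹ * ∫ k in (0 : ℝ)..2 * π, pmSymbol R lam k * fejerDensity ω σ v W k ≤ pmValue R lam := by
  unfold pmValue
  refine mul_le_mul_of_nonneg_left ?_ (by positivity)
  refine intervalIntegral.integral_mono_on (by positivity) ?_ ?_ fun k _ => ?_
  · exact ((continuous_pmSymbol R lam).mul (continuous_fejerDensity ω σ v W)).intervalIntegrable _ _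
  · exact ((continuous_pmSymbol R lam).max continuous_const).intervalIntegrable _ _
  · have hn := fejerDensity_mem_Icc ω σ hω hv hW k
    calc pmSymbol R lam k * fejerDensity ω σ v W k
        ≤ max (pmSymbol R lam k) 0 * fejerDensity ω σ v W k :=
          mul_le_mul_of_nonneg_right (le_max_left _ _) hn.1
      _ ≤ max (pmSymbol R lam k) 0 := mul_le_of_le_one_right (le_max_right _ _) hn.2

end Fejer

/-! ### §5. Lemma PM -/

section Main

variable (ω : InfVolFermionState d) (σ : Fin 2)

/-- The damped row at window `W > R`:
`(1/2π) ∫ p_λ n_W = λ₀ Re G(0,0) + Σ_e (1 − e/W)(λ_e Re G(0, ev) + λ_e Re G(0, −ev))`. -/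
theorem dampedRow_eq (v : Site d) (R : ℕ) (lam : ℕ → ℝ) {W : ℕ} (hW : R < W) :
    (2 * π)⁻¹ * ∫ k in (0 : ℝ)..2 * π, pmSymbol R lam k * fejerDensity ω σ v W k =
      lam 0 * (ω.twoPoint σ 0 0).re + ∑ e ∈ Finset.Icc 1 R, (1 - (e : ℝ) / W) *
        (lam e * (ω.twoPoint σ 0 ((e : ℤ) • v)).re + lam e * (ω.twoPoint σ 0 ((-(e : ℤ)) • v)).re) := by
  rw [integral_pmSymbol_mul_fejerDensity]
  have hF := fejer_sum_eq (fun m : ℤ => pmCoeff R lam m * (ω.twoPoint σ 0 (m • v)).re) R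
    (fun m hm => by simp [pmCoeff_eq_zero_of_lt R lam hm]) hW
  have hπ : (2 * π)⁻¹ * (2 * π * (W : ℝ)⁻¹ * ∑ j : Fin W, ∑ l : Fin W,
      pmCoeff R lam (((l : ℕ) : ℤ) - ((j : ℕ) : ℤ)) * (ω.twoPoint σ 0 ((((l : ℕ) : ℤ) - ((j : ℕ) : ℤ)) • v)).re) =
      (W : ℝ)⁻¹ * ∑ j : Fin W, ∑ l : Fin W,
      pmCoeff R lam (((l : ℕ) : ℤ) - ((j : ℕ) : ℤ)) * (ω.twoPoint σ 0 ((((l : ℕ) : ℤ) - ((j : ℕ) : ℤ)) • v)).re := by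
    have h2π : (2 * π : ℝ) ≠ 0 := by positivity
    rw [← mul_assoc, ← mul_assoc, inv_mul_cancel₀ h2π, one_mul]
  rw [hπ, hF]
  simp only [zero_smul, pmCoeff_zero]
  congr 1
  refine Finset.sum_congr rfl fun e he => ?_
  rw [Finset.mem_Icc] at he
  rw [pmCoeff_neg, pmCoeff_natCast R lam he.2]

/-- **LEMMA PM (two-point form).** For a translation-invariant infinite-volume lattice fermion state
`ω`, a spin `σ`, a direction `v ≠ 0` and real `λ₀, …, λ_R`:
`λ₀ ω(n_{0σ}) + Σ_{e=1}^{R} λ_e Re(ω(c†_{0σ}c_{ev,σ}) + ω(c†_{ev,σ}c_{0σ})) ≤ PM(λ)`.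
(op-07 TL-FORMULATION §A.6, refereed ref-1 R1.16; inputs Lieb–Seiringer Thm. 3.2 (3.1.35).) -/
theorem _root_.Literature.MathematicalPhysics.QuantumLattice.InfVolFermionState.IsTranslationInvariant.pauliMarkov
    (hω : ω.IsTranslationInvariant) {v : Site d} (hv : v ≠ 0) (R : ℕ) (lam : ℕ → ℝ) :
    lam 0 * (ω.twoPoint σ 0 0).re + ∑ e ∈ Finset.Icc 1 R,
      lam e * ((ω.twoPoint σ 0 ((e : ℤ) • v)).re + (ω.twoPoint σ ((e : ℤ) • v) 0).re) ≤ pmValue R lam := by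
  -- the damped rows `S n` at windows `W = n + R + 1` are all `≤ PM(λ)` and converge to the row
  set L : ℝ := lam 0 * (ω.twoPoint σ 0 0).re + ∑ e ∈ Finset.Icc 1 R,
    (lam e * (ω.twoPoint σ 0 ((e : ℤ) • v)).re + lam e * (ω.twoPoint σ 0 ((-(e : ℤ)) • v)).re) with hL
  set S : ℕ → ℝ := fun n => lam 0 * (ω.twoPoint σ 0 0).re + ∑ e ∈ Finset.Icc 1 R,
    (1 - (e : ℝ) / ((n + R + 1 : ℕ) : ℝ)) *
      (lam e * (ω.twoPoint σ 0 ((e : ℤ) • v)).re + lam e * (ω.twoPoint σ 0 ((-(e : ℤ)) • v)).re) with hS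
  have hle : ∀ n, S n ≤ pmValue R lam := by
    intro n
    have h := integral_pmSymbol_mul_fejerDensity_le ω σ hω hv R lam (W := n + R + 1) (by omega)
    rwa [dampedRow_eq ω σ v R lam (W := n + R + 1) (by omega)] at h
  have hlim : Filter.Tendsto S Filter.atTop (nhds L) := by
    refine tendsto_const_nhds.add (tendsto_finsetSum _ fun e _ => ?_)
    have h1 : Filter.Tendsto (fun n : ℕ => (e : ℝ) / ((n + R + 1 : ℕ) : ℝ)) Filter.atTop (nhds 0) := by
      have h := (tendsto_const_div_atTop_nhds_zero_nat (e : ℝ)).comp (Filter.tendsto_add_atTop_nat (R + 1))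
      refine h.congr fun n => ?_
      simp only [Function.comp_apply, Nat.add_assoc]
    have h2 := ((tendsto_const_nhds (x := (1 : ℝ))).sub h1).mul_const
      (lam e * (ω.twoPoint σ 0 ((e : ℤ) • v)).re + lam e * (ω.twoPoint σ 0 ((-(e : ℤ)) • v)).re)
    simpa using h2
  have hmain : L ≤ pmValue R lam := le_of_tendsto' hlim hle
  have hrow : lam 0 * (ω.twoPoint σ 0 0).re + ∑ e ∈ Finset.Icc 1 R,
      lam e * ((ω.twoPoint σ 0 ((e : ℤ) • v)).re + (ω.twoPoint σ ((e : ℤ) • v) 0).re) = L := by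
    simp only [hL]
    congr 1
    refine Finset.sum_congr rfl fun e _ => ?_
    rw [mul_add, hω.twoPoint_eq_zero_sub ω σ ((e : ℤ) • v) 0, zero_sub, ← neg_smul]
  exact hrow ▸ hmain

end Main

/-! ### §6. Operator form on a region containing `0, v, …, R v` -/

section Operator

variable (ω : InfVolFermionState d) (σ : Fin 2)

/-- **The Pauli–Markov one-body operator**
`O_λ = λ₀ n_{0σ} + Σ_{e=1}^{R} λ_e (c†_{0σ} c_{ev,σ} + c†_{ev,σ} c_{0σ})` in a region `Λ` containing the
sites `0` and `e v`, `1 ≤ e ≤ R` (memberships supplied by the caller). -/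
def pmOp (R : ℕ) (lam : ℕ → ℝ) (v : Site d) (σ : Fin 2) (Λ : Finset (Site d)) (h0 : (0 : Site d) ∈ Λ)
    (hmem : ∀ e ∈ Finset.Icc 1 R, ((e : ℤ) • v) ∈ Λ) : FermionOp Λ :=
  ((lam 0 : ℝ) : ℂ) • nAt 0 h0 σ +
    ∑ e ∈ (Finset.Icc 1 R).attach, ((lam e : ℝ) : ℂ) •
      ((cAt 0 h0 σ)ᴴ * cAt (((e : ℕ) : ℤ) • v) (hmem e e.2) σ +
        (cAt (((e : ℕ) : ℤ) • v) (hmem e e.2) σ)ᴴ * cAt 0 h0 σ)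

/-- **LEMMA PM (operator form).** For translation-invariant `ω`, `v ≠ 0` and any region `Λ ∋ 0, v, …, Rv`:
`Re ω(O_λ) ≤ PM(λ)`. -/
theorem re_expect_pmOp_le (hω : ω.IsTranslationInvariant) {v : Site d} (hv : v ≠ 0) (R : ℕ) (lam : ℕ → ℝ)
    (Λ : Finset (Site d)) (h0 : (0 : Site d) ∈ Λ) (hmem : ∀ e ∈ Finset.Icc 1 R, ((e : ℤ) • v) ∈ Λ) :
    (ω.expect Λ (pmOp R lam v σ Λ h0 hmem)).re ≤ pmValue R lam := by
  have key := hω.pauliMarkov ω σ hv R lam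
  have hexp : ω.expect Λ (pmOp R lam v σ Λ h0 hmem) = ((lam 0 : ℝ) : ℂ) * ω.twoPoint σ 0 0 +
      ∑ e ∈ Finset.Icc 1 R, ((lam e : ℝ) : ℂ) *
        (ω.twoPoint σ 0 ((e : ℤ) • v) + ω.twoPoint σ ((e : ℤ) • v) 0) := by
    rw [pmOp, map_add, map_smul, map_sum, ω.expect_nAt_eq_twoPoint, smul_eq_mul]
    congr 1
    rw [← Finset.sum_attach (Finset.Icc 1 R) (fun e => ((lam e : ℝ) : ℂ) *
      (ω.twoPoint σ 0 ((e : ℤ) • v) + ω.twoPoint σ ((e : ℤ) • v) 0))]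
    refine Finset.sum_congr rfl fun e _ => ?_
    rw [map_smul, map_add, ω.expect_creation_mul_annihilation, ω.expect_creation_mul_annihilation, smul_eq_mul]
  rw [hexp, Complex.add_re, Complex.re_sum, Complex.re_ofReal_mul]
  simp_rw [Complex.re_ofReal_mul, Complex.add_re]
  exact key

/-- Isotony: embedding `O_λ` into a larger region gives `O_λ` there. -/
theorem fermionEmbed_incl_pmOp (R : ℕ) (lam : ℕ → ℝ) (v : Site d) {Λ Λ' : Finset (Site d)} (h : Λ ⊆ Λ')
    (h0 : (0 : Site d) ∈ Λ) (hmem : ∀ e ∈ Finset.Icc 1 R, ((e : ℤ) • v) ∈ Λ) :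
    fermionEmbed (PolySite.incl h) (pmOp R lam v σ Λ h0 hmem) =
      pmOp R lam v σ Λ' (h h0) (fun e he => h (hmem e he)) := by
  simp only [pmOp, map_add, map_smul, map_sum, map_mul, fermionEmbed_conjTranspose, fermionEmbed_incl_cAt, nAt,
    fermionEmbed_numberOp, PolySite.incl_pt]

/-- **Slack form for certificates.** For PM rows `(σ_i, λ^{(i)}, R_i)` with multipliers `κ_i ≥ 0` and
certified bounds `PM(λ^{(i)}) ≤ B_i`, the dualised slack `S = Σ_i κ_i (B_i 𝟙 − O_{λ^{(i)}})` has
`Re ω(S) ≥ 0` in every translation-invariant state: so a certificate identity with objective `h − S`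
(PM rows moved into the objective) bounds `Re ω(h) ≥ Re ω(h − S)`. -/
theorem re_expect_pmSlack_nonneg (hω : ω.IsTranslationInvariant) {v : Site d} (hv : v ≠ 0)
    {Λ : Finset (Site d)} (h0 : (0 : Site d) ∈ Λ) {ι : Type*} (s : Finset ι) (τ : ι → Fin 2) (R : ι → ℕ)
    (lam : ι → ℕ → ℝ) (hmem : ∀ i, ∀ e ∈ Finset.Icc 1 (R i), ((e : ℤ) • v) ∈ Λ) (κ B : ι → ℝ)
    (hκ : ∀ i ∈ s, 0 ≤ κ i) (hB : ∀ i ∈ s, pmValue (R i) (lam i) ≤ B i) :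
    0 ≤ (ω.expect Λ (∑ i ∈ s, ((κ i : ℝ) : ℂ) •
      (((B i : ℝ) : ℂ) • (1 : FermionOp Λ) - pmOp (R i) (lam i) v (τ i) Λ h0 (hmem i)))).re := by
  rw [map_sum, Complex.re_sum]
  refine Finset.sum_nonneg fun i hi => ?_
  rw [map_smul, smul_eq_mul, Complex.re_ofReal_mul, map_sub, map_smul, ω.expect_one, smul_eq_mul, mul_one,
    Complex.sub_re, Complex.ofReal_re]
  refine mul_nonneg (hκ i hi) (sub_nonneg.2 ?_)
  exact (re_expect_pmOp_le ω (τ i) hω hv (R i) (lam i) Λ h0 (hmem i)).trans (hB i hi)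

/-- The same in difference form: `Re ω(X − S) ≤ Re ω(X)` for the PM slack `S`. -/
theorem re_expect_sub_pmSlack_le (hω : ω.IsTranslationInvariant) {v : Site d} (hv : v ≠ 0)
    {Λ : Finset (Site d)} (h0 : (0 : Site d) ∈ Λ) {ι : Type*} (s : Finset ι) (τ : ι → Fin 2) (R : ι → ℕ)
    (lam : ι → ℕ → ℝ) (hmem : ∀ i, ∀ e ∈ Finset.Icc 1 (R i), ((e : ℤ) • v) ∈ Λ) (κ B : ι → ℝ)
    (hκ : ∀ i ∈ s, 0 ≤ κ i) (hB : ∀ i ∈ s, pmValue (R i) (lam i) ≤ B i) (X : FermionOp Λ) :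
    (ω.expect Λ (X - ∑ i ∈ s, ((κ i : ℝ) : ℂ) •
      (((B i : ℝ) : ℂ) • (1 : FermionOp Λ) - pmOp (R i) (lam i) v (τ i) Λ h0 (hmem i)))).re ≤
      (ω.expect Λ X).re := by
  rw [map_sub, Complex.sub_re]
  linarith [re_expect_pmSlack_nonneg ω hω hv h0 s τ R lam hmem κ B hκ hB]

end Operator

end Summit.Ventures.CertifiedManyBodySolver.Transport

end
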